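import Literature.Analysis.FluidPDE.NormalisedPressureBilinear
import HarnessLib

/-!
# The `L^p` bound for the difference of two Riesz-transform pressures

Analysis/FluidPDE theorem file (no definitions, no named facts). For the normalised (Riesz-transform)
pressure `p̃[v] = −|v|²/3 + p.v. ∫ K(·−y)(v(y)) dy` of the tree (`normalisedPressure`; Tao 2011, (42);
Stein 1970, Ch. III §1) and `1 < p < ∞` there is a constant `C_p < ∞` such that for measurable
fields `a, b : ℝ³ → ℝ³` with `|a|², |b|² ∈ L^p`,

  `‖p̃[a] − p̃[b]‖_{L^p} ≤ C_p ‖ |a − b| · |a + b| ‖_{L^p}`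

(`exists_eLpNorm_normalisedPressure_sub_le`): `K(a) − K(b) = B(a − b, a + b)` for the symmetric
bilinear form of the kernel, so that `p̃[a] − p̃[b] = −⟨a−b, a+b⟩/3 + p.v.∫ B(a−b, a+b)` at almost
every point, and the bilinear Calderón–Zygmund inequality of the tree (`exists_bilinear_pv`;
Stein 1970, Ch. II §4.2 Thm. 3, §4.5 Thm. 4) bounds the principal value. This is the continuity of
`v ↦ p̃[v]` from `L^{2p}` to `L^p` on bounded sets (Tsai 1998, p. 34: "We then extend this result to
general `U ∈ L^q` by approximation"), in the form consumed by the passage to the limit in the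
pressures of Leray's regularised scheme (`LeraySchemePressure*.lean`). The pattern of proof is that
of `exists_normalisedPressure_sub_eq_add₃` (`NormalisedPressureBilinear.lean`, the weak–strong
decomposition), with a single bilinear principal value.

## References

* E. M. Stein, *Singular integrals and differentiability properties of functions* (1970),
  Ch. II §4.2 Thm. 3, §4.5 Thm. 4; Ch. III §1. [Stein1970]
* T.-P. Tsai, ARMA 143 (1998), proof of Lemma 2.1, p. 34. [Tsai1998]
* T. Tao, Anal. PDE 6 (2013) = arXiv:1108.1165, (42). [Tao2011]
-/

noncomputable section

open MeasureTheory Set Filter Topology Function Metric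
open scoped ENNReal NNReal RealInnerProductSpace

namespace Literature.Analysis.FluidPDE

-- nested operator types in the imported pressure files
set_option maxSynthPendingDepth 3

variable {p : ℝ≥0∞}

/-- `|a − b| |a + b| ∈ L^p` when `|a|², |b|² ∈ L^p` (`|a−b||a+b| ≤ (|a|+|b|)² ≤ 2|a|² + 2|b|²`).
[folklore] -/
theorem memLp_norm_sub_mul_norm_add {a b : EuclideanSpace ℝ (Fin 3) → EuclideanSpace ℝ (Fin 3)}
    (ha : AEStronglyMeasurable a volume) (hb : AEStronglyMeasurable b volume)
    (ha2 : MemLp (fun y => ‖a y‖ ^ 2) p volume) (hb2 : MemLp (fun y => ‖b y‖ ^ 2) p volume) :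
    MemLp (fun y => ‖a y - b y‖ * ‖a y + b y‖) p volume := by
  have hsum : MemLp (fun y => 2 * ‖a y‖ ^ 2 + 2 * ‖b y‖ ^ 2) p volume :=
    (ha2.const_mul 2).add (hb2.const_mul 2)
  refine hsum.of_le ((ha.sub hb).norm.mul (ha.add hb).norm) (Eventually.of_forall fun y => ?_)
  rw [Real.norm_eq_abs, Real.norm_eq_abs, abs_of_nonneg (by positivity), abs_of_nonneg (by positivity)]
  have h1 := norm_sub_le (a y) (b y)
  have h2 := norm_add_le (a y) (b y)
  have h' : ‖a y - b y‖ * ‖a y + b y‖ ≤ (‖a y‖ + ‖b y‖) * (‖a y‖ + ‖b y‖) :=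
    mul_le_mul h1 h2 (norm_nonneg _) (by positivity)
  nlinarith [sq_nonneg (‖a y‖ - ‖b y‖)]

/-- **The `L^p` bound for the difference of two normalised pressures** (`1 < p < ∞`): there is
`C < ∞` with `‖p̃[a] − p̃[b]‖_p ≤ C ‖|a − b| |a + b|‖_p` for all measurable `a, b` with
`|a|², |b|² ∈ L^p` (Stein 1970, Ch. II §4.2 Thm. 3 with §4.5 Thm. 4, in the bilinear form
`exists_bilinear_pv`; Tsai 1998, p. 34). [cite: Stein1970, Ch. II §4.2 Thm. 3, §4.5 Thm. 4] -/
theorem exists_eLpNorm_normalisedPressure_sub_le (hp1 : 1 < p) (hp2 : p < ⊤) :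
    ∃ C : ℝ≥0∞, C ≠ ⊤ ∧ ∀ a b : EuclideanSpace ℝ (Fin 3) → EuclideanSpace ℝ (Fin 3),
      AEStronglyMeasurable a volume → AEStronglyMeasurable b volume →
      MemLp (fun y => ‖a y‖ ^ 2) p volume → MemLp (fun y => ‖b y‖ ^ 2) p volume →
      eLpNorm (fun x => normalisedPressure a x - normalisedPressure b x) p volume ≤
        C * eLpNorm (fun y => ‖a y - b y‖ * ‖a y + b y‖) p volume := by
  obtain ⟨A, hAt, hA⟩ := exists_eLpNorm_rieszTrunc_le (p := p) hp1 hp2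
  set K : ℝ≥0∞ := 27 * 2⁻¹ * A with hK
  have hKt : K ≠ ⊤ := by simp only [hK]; finiteness
  set C : ℝ≥0∞ := 3⁻¹ + K with hC
  have hCt : C ≠ ⊤ := by simp only [hC]; finiteness
  refine ⟨C, hCt, fun a b ha hb ha2 hb2 => ?_⟩
  have hp1' : 1 ≤ p := hp1.le
  -- abbreviations
  set c : EuclideanSpace ℝ (Fin 3) → EuclideanSpace ℝ (Fin 3) := fun y => a y - b y with hc
  set d : EuclideanSpace ℝ (Fin 3) → EuclideanSpace ℝ (Fin 3) := fun y => a y + b y with hd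
  have hcm : AEStronglyMeasurable c volume := ha.sub hb
  have hdm : AEStronglyMeasurable d volume := ha.add hb
  have hcd : MemLp (fun y => ‖c y‖ * ‖d y‖) p volume := memLp_norm_sub_mul_norm_add ha hb ha2 hb2
  -- the bilinear principal value of `(c, d)`
  obtain ⟨P, hPm, hP, hPb⟩ := exists_bilinear_pv (f := c) (g := d) hp1 hp2 hA hcm hdm hcd
  -- the principal values of `a` and `b` exist a.e.
  have hPVa := ae_exists_hasPressurePV hp1 hp2 ha ha2
  have hPVb := ae_exists_hasPressurePV hp1 hp2 hb hb2
  -- conjugate exponent for the integrability of the truncations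
  set q : ℝ≥0∞ := ENNReal.conjExponent p with hq
  haveI hpq : ENNReal.HolderConjugate p q := ENNReal.HolderConjugate.conjExponent hp1'
  have hq1 : 1 < q := (ENNReal.HolderConjugate.lt_top_iff_one_lt p q).1 hp2
  have hqt : q ≠ ⊤ := (ENNReal.HolderConjugate.ne_top_iff_ne_one q p).2 (ne_of_gt hp1)
  -- the identity a.e.
  have hident : (fun x => normalisedPressure a x - normalisedPressure b x) =ᵐ[volume]
      fun x => -(3⁻¹ : ℝ) * ⟪c x, d x⟫ + P x := by
    filter_upwards [hPVa, hPVb, hP] with x hxa hxb hx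
    obtain ⟨La, hLa⟩ := hxa
    obtain ⟨Lb, hLb⟩ := hxb
    have htrunc : ∀ ε : ℝ, 0 < ε → truncatedPressureIntegral a x ε - truncatedPressureIntegral b x ε =
        ∫ y in (closedBall x ε)ᶜ, pressureForm (x - y) (c y) (d y) := by
      intro ε hε
      have hIa := integrableOn_pressureKernel_of_memLp hq1 hqt ha ha2 x hε
      have hIb := integrableOn_pressureKernel_of_memLp hq1 hqt hb hb2 x hε
      rw [truncatedPressureIntegral_sub_eq hIa hIb]
      rfl
    have hlim : Tendsto (fun ε => truncatedPressureIntegral a x ε - truncatedPressureIntegral b x ε) (𝓝[>] 0)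
        (𝓝 (P x)) := by
      refine hx.congr' ?_
      filter_upwards [self_mem_nhdsWithin] with ε hε
      exact (htrunc ε hε).symm
    have hlim' : Tendsto (fun ε => truncatedPressureIntegral a x ε - truncatedPressureIntegral b x ε) (𝓝[>] 0)
        (𝓝 (La - Lb)) := hLa.2.sub hLb.2
    have hLL : La - Lb = P x := tendsto_nhds_unique hlim' hlim
    rw [normalisedPressure_sub_eq hLa hLb, hLL, norm_sq_sub_norm_sq_eq_inner]
    simp only [hc, hd]
    ring
  rw [eLpNorm_congr_ae hident]
  -- the two pieces
  have hm1 : AEStronglyMeasurable (fun x => -(3⁻¹ : ℝ) * ⟪c x, d x⟫) volume := (hcm.inner hdm).const_mul _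
  calc eLpNorm (fun x => -(3⁻¹ : ℝ) * ⟪c x, d x⟫ + P x) p volume
      ≤ eLpNorm (fun x => -(3⁻¹ : ℝ) * ⟪c x, d x⟫) p volume + eLpNorm P p volume :=
        eLpNorm_add_le hm1 hPm hp1'
    _ ≤ 3⁻¹ * eLpNorm (fun y => ‖c y‖ * ‖d y‖) p volume + K * eLpNorm (fun y => ‖c y‖ * ‖d y‖) p volume := by
        gcongr
        · have e1 : (fun x => -(3⁻¹ : ℝ) * ⟪c x, d x⟫) = (-(3⁻¹) : ℝ) • fun x => ⟪c x, d x⟫ := by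
            funext x; simp only [Pi.smul_apply, smul_eq_mul]
          rw [e1, eLpNorm_const_smul, enorm_neg, Real.enorm_eq_ofReal (by norm_num),
            ENNReal.ofReal_inv_of_pos (by norm_num), ENNReal.ofReal_ofNat]
          exact mul_le_mul' le_rfl (eLpNorm_inner_le c d p)
    _ = C * eLpNorm (fun y => ‖c y‖ * ‖d y‖) p volume := by
        rw [← add_mul]

/-- **Corollary: the `L^p` bound of one normalised pressure** in the same form
(`b = 0`: `‖p̃[a]‖_p ≤ C ‖|a|²‖_p`), with the constant of
`exists_eLpNorm_normalisedPressure_sub_le`. [cite: Stein1970, Ch. II §4.2 Thm. 3] -/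
theorem eLpNorm_normalisedPressure_le_of_sub_bound {C : ℝ≥0∞}
    (hC : ∀ a b : EuclideanSpace ℝ (Fin 3) → EuclideanSpace ℝ (Fin 3),
      AEStronglyMeasurable a volume → AEStronglyMeasurable b volume →
      MemLp (fun y => ‖a y‖ ^ 2) p volume → MemLp (fun y => ‖b y‖ ^ 2) p volume →
      eLpNorm (fun x => normalisedPressure a x - normalisedPressure b x) p volume ≤
        C * eLpNorm (fun y => ‖a y - b y‖ * ‖a y + b y‖) p volume)
    {a : EuclideanSpace ℝ (Fin 3) → EuclideanSpace ℝ (Fin 3)} (ha : AEStronglyMeasurable a volume)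
    (ha2 : MemLp (fun y => ‖a y‖ ^ 2) p volume) :
    eLpNorm (normalisedPressure a) p volume ≤ C * eLpNorm (fun y => ‖a y‖ ^ 2) p volume := by
  have h0 : MemLp (fun y : EuclideanSpace ℝ (Fin 3) => ‖(0 : EuclideanSpace ℝ (Fin 3) → EuclideanSpace ℝ (Fin 3)) y‖ ^ 2) p volume := by
    simp only [Pi.zero_apply, norm_zero, ne_eq, OfNat.ofNat_ne_zero, not_false_eq_true, zero_pow]
    exact MemLp.zero
  have h := hC a 0 ha aestronglyMeasurable_const ha2 h0
  simp only [normalisedPressure_zero, Pi.zero_apply, sub_zero, add_zero] at h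
  have e : (fun y => ‖a y‖ * ‖a y‖) = fun y => ‖a y‖ ^ 2 := by funext y; ring
  rw [e] at h
  exact h

end Literature.Analysis.FluidPDE
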